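import Literature.NumberTheory.Automorphic.ArchRankOneCasimirLadderCayley   -- ★ p850774 (α2) (LH3-p01 (g4)): `exists_two_sin_smul_orbitalIntegral_cayley_eq` (THE frame identity), Cayley heads; brings ★ `ArchRankOneCasimirUniform`
import Literature.NumberTheory.Automorphic.ArchRankOneCasimirUniformJump     -- ★ p850822 (LH3-p04 (g4)): `exists_tendsto_iteratedDeriv_orbitalIntegral_comp_clm_uniform`, `eventually_forall_norm_clm_sub_le_of_tendsto`
import Literature.NumberTheory.Automorphic.ArchRankOneCasimirParamAverage   -- ★ p850932 (α4-S3): brings ★ `isCompact_setOf_exists_conj_endoBlock_mem_of_not_mem`, `isClosedEmbedding_coe_unitaryGroupOfForm_of_eq_over`, ★ atlas `endoBlock`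
import HarnessLib

/-!
# The Cayley frame of `U(Φ₂)_w`, off-wall half: `F f` is `C^∞` on the punctured interval, its jets commute with continuous linear maps there, and the one-sided limits of the
# jets of a curried family are attained UNIFORMLY (Varadarajan 1989 §6.4 Thms 22–24; Bouaziz 1994 §3.1 (I₂)–(I₃); Rogawski 1990 §8.2)

Topic `NumberTheory/Automorphic`; namespace `Literature.NumberTheory.Automorphic.UnitaryGroup`.  THEOREMS ONLY (no `def`, no instance, no notation, no axiom, no `sorry`).
Cell `pub/hodgecm-mathlib`, crux H413 (`stmt-HodgeConjecture-24833`), line LH3 (closer stub `stub_N9`, DIRECT ROAD), letter L3′ organ O-L3′ conjunct (ii) for GENERAL `fH`, (α4)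
«all-orders transport», stage **(α4-S6) «multi-wall base points»** (LH3-plan (g3) 10:09:22Z; census `F0/P3c/LH10/LH10-p01/g4/s6/CENSUS-alpha4-S6.v1.md`), brick (S6-B4′).  Seat
LH10-p01 (g4).  Count-neutral.

THE POINT.  ★ (α2) `ArchRankOneCasimirLadderCayley` docks the diagonal-frame engine (★ `RankOneCasimir.*` at `a = (2, −2)`, `p = q = 1`) onto the tree's Cayley chart of `U(Φ₂)_w` for the
BOUNDS (`…cayley_le`, `…cayley_comp_clm_le`) and the ONE-SIDED LIMITS (`…cayley_nhdsGT_nhdsLT`).  The induction step of (α4-S6) also needs, in the SAME Cayley frame, the three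
off-wall facts that ★ `ArchRankOneCasimirUniform`∕`…UniformJump` prove in the diagonal frame — transported here by the same frame identity ★ `exists_two_sin_smul_orbitalIntegral_cayley_eq`
(`F f` in the Cayley frame IS the engine's functional of `X ↦ f(P X P⁻¹)` against the transported Haar measure):
* **`contDiffOn_orbitalIntegral_cayley_punctured`** — `ContDiffOn ℝ ∞ (F f) (Ioo (−1) 1 ∩ {0}ᶜ)` for `f ∈ C_c^∞(M₂(ℂ), E)` (the continuity of `ψ_k ↦ (F′ g)⁽ⁿ⁾ ψ_k` off the face,
  hypothesis `hu` of ★ (S6-B3) `Literature.Topology.continuousOn_eval_Ico_glue_of_tendsto`);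
* **`iteratedDeriv_orbitalIntegral_cayley_comp_clm`** — `(F (ℓ ∘ g))⁽ⁿ⁾ ψ = ℓ ((F′ g)⁽ⁿ⁾ ψ)` for `0 < |ψ| < 1` (reading the mixed partial at parameter `p′` out of the `(P′ →ᵇ E)`-valued jet:
  `ℓ = evalCLM ℝ p′`);
* **`exists_tendsto_iteratedDeriv_orbitalIntegral_cayley_comp_clm_uniform`** — ONE pair `Lp, Lm ∈ E′` with the `E′`-valued one-sided limits of `(F′ g)⁽ⁿ⁾` AND, for every `ε > 0`, ONE
  side-neighbourhood on which `‖(F (ℓ ∘ g))⁽ⁿ⁾ ψ − ℓ Lp‖ ≤ ‖ℓ‖ ε` for ALL `ℓ` (the sup-norm convergence ★ (S6-B3) consumes, read back through every evaluation).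
HONEST LABEL: HC_CM is proved only modulo the 7 printed citations (2 remaining: hLiu418 = `stmt-HodgeConjecture-24832`, h413 = `stmt-HodgeConjecture-24833`) until rung 0 closes;
frame transport only, pays nothing by itself.

## References
* [Varadarajan1989] V. S. Varadarajan, *An Introduction to Harmonic Analysis on Semisimple Lie Groups*, Cambridge Stud. Adv. Math. 16 (1989), §6.4 Thms 22–24.
* [Bouaziz1994IntegralesOrbitales] A. Bouaziz, *Intégrales orbitales sur les algèbres de Lie réductives*, Invent. Math. 115 (1994), §3.1 (I₂) p. 579, §3.2 (I₃) p. 580.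
* [Rogawski1990] J. D. Rogawski, *Automorphic Representations of Unitary Groups in Three Variables*, Ann. of Math. Stud. 123 (1990), §8.2 pp. 119–122.
* [PlatonovRapinchuk1994] V. Platonov, A. Rapinchuk, *Algebraic Groups and Number Theory* (1994), §2.3.
-/

set_option autoImplicit false

noncomputable section

namespace Literature.NumberTheory.Automorphic.UnitaryGroup

open _root_.Complex _root_.Matrix _root_.MeasureTheory _root_.Set _root_.Filter _root_.Topology _root_.NumberField _root_.NumberField.InfinitePlace
open Literature.NumberTheory.Automorphic.RankOneCasimir Literature.NumberTheory.Automorphic.ArchCartan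
open scoped Matrix.Norms.Operator MatrixGroups ComplexConjugate ContDiff Real

/-! ## §1 Frame bookkeeping at `a = (2, −2)`, `p = q = 1` (local copies of ★ (α2)'s private helpers) -/

section Frame

variable (L : Type) [Field L] [NumberField L] (w : {w : InfinitePlace L // IsComplex w})

-- adapted from ★ `ArchRankOneCasimirLadderCayley` (private `contDiff_hasCompactSupport_comp_cayley`)
/-- `X ↦ f(P X P⁻¹)` is `C_c^∞` when `f` is (`P = (1,1;1,−1)`, `P⁻¹ = ½ P`). [cite: PlatonovRapinchuk1994, §2.3] -/
private theorem contDiff_hasCompactSupport_comp_cayley' {E' : Type*} [NormedAddCommGroup E'] [NormedSpace ℝ E'] {f : Matrix (Fin 2) (Fin 2) ℂ → E'}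
    (hf : ContDiff ℝ ∞ f) (hfc : HasCompactSupport f) :
    ContDiff ℝ ∞ (fun X : Matrix (Fin 2) (Fin 2) ℂ => f ((!![(1 : ℂ), 1; 1, -1] : Matrix (Fin 2) (Fin 2) ℂ) * X * !![(1 / 2 : ℂ), 1 / 2; 1 / 2, -(1 / 2)])) ∧
      HasCompactSupport (fun X : Matrix (Fin 2) (Fin 2) ℂ => f ((!![(1 : ℂ), 1; 1, -1] : Matrix (Fin 2) (Fin 2) ℂ) * X * !![(1 / 2 : ℂ), 1 / 2; 1 / 2, -(1 / 2)])) := by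
  refine ⟨hf.comp ((contDiff_const.mul contDiff_id).mul contDiff_const), ?_⟩
  have hAB : (!![(1 : ℂ), 1; 1, -1] : Matrix (Fin 2) (Fin 2) ℂ) * !![(1 / 2 : ℂ), 1 / 2; 1 / 2, -(1 / 2)] = 1 := by
    ext i j; fin_cases i <;> fin_cases j <;> simp [Matrix.mul_apply, Fin.sum_univ_two] <;> norm_num
  have hBA : (!![(1 / 2 : ℂ), 1 / 2; 1 / 2, -(1 / 2)] : Matrix (Fin 2) (Fin 2) ℂ) * !![(1 : ℂ), 1; 1, -1] = 1 := by
    ext i j; fin_cases i <;> fin_cases j <;> simp [Matrix.mul_apply, Fin.sum_univ_two] <;> norm_num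
  let φ : Matrix (Fin 2) (Fin 2) ℂ ≃ₜ Matrix (Fin 2) (Fin 2) ℂ :=
    { toFun := fun X => (!![(1 : ℂ), 1; 1, -1] : Matrix (Fin 2) (Fin 2) ℂ) * X * !![(1 / 2 : ℂ), 1 / 2; 1 / 2, -(1 / 2)]
      invFun := fun X => (!![(1 / 2 : ℂ), 1 / 2; 1 / 2, -(1 / 2)] : Matrix (Fin 2) (Fin 2) ℂ) * X * !![(1 : ℂ), 1; 1, -1]
      left_inv := fun X => by
        show (!![(1 / 2 : ℂ), 1 / 2; 1 / 2, -(1 / 2)] : Matrix (Fin 2) (Fin 2) ℂ) * ((!![(1 : ℂ), 1; 1, -1] : Matrix (Fin 2) (Fin 2) ℂ) * X *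
          !![(1 / 2 : ℂ), 1 / 2; 1 / 2, -(1 / 2)]) * !![(1 : ℂ), 1; 1, -1] = X
        rw [← Matrix.mul_assoc, ← Matrix.mul_assoc, hBA, Matrix.one_mul, Matrix.mul_assoc, hBA, Matrix.mul_one]
      right_inv := fun X => by
        show (!![(1 : ℂ), 1; 1, -1] : Matrix (Fin 2) (Fin 2) ℂ) * ((!![(1 / 2 : ℂ), 1 / 2; 1 / 2, -(1 / 2)] : Matrix (Fin 2) (Fin 2) ℂ) * X *
          !![(1 : ℂ), 1; 1, -1]) * !![(1 / 2 : ℂ), 1 / 2; 1 / 2, -(1 / 2)] = X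
        rw [← Matrix.mul_assoc, ← Matrix.mul_assoc, hAB, Matrix.one_mul, Matrix.mul_assoc, hAB, Matrix.mul_one]
      continuous_toFun := (continuous_const.mul continuous_id).mul continuous_const
      continuous_invFun := (continuous_const.mul continuous_id).mul continuous_const }
  exact hfc.comp_homeomorph φ

-- adapted from ★ `ArchRankOneCasimirLadderCayley` (private `cayleyDiag_frame`)
/-- The engine's side conditions at `a = (2, −2)`: `a_i ≠ 0`, `σ_w(a_i)` real, `re σ_w(2) · re σ_w(−2) < 0`, and `1² σ_w(−2) = −σ_w(2)`. [cite: Rogawski1990, §8.2 p. 122] -/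
private theorem cayleyDiag_frame' :
    (∀ i, (![(2 : L), -2]) i ≠ 0) ∧ (∀ i, (w.1.embedding ((![(2 : L), -2]) i)).im = 0) ∧
      (w.1.embedding ((![(2 : L), -2]) 0)).re * (w.1.embedding ((![(2 : L), -2]) 1)).re < 0 ∧
      ((1 : ℝ) : ℂ) ^ 2 * w.1.embedding ((![(2 : L), -2]) 1) = -w.1.embedding ((![(2 : L), -2]) 0) := by
  have h0 : w.1.embedding ((![(2 : L), -2]) 0) = 2 := by
    rw [show (![(2 : L), -2]) 0 = 2 from rfl, map_ofNat]
  have h1 : w.1.embedding ((![(2 : L), -2]) 1) = -2 := by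
    rw [show (![(2 : L), -2]) 1 = -2 from rfl, map_neg, map_ofNat]
  refine ⟨fun i => ?_, fun i => ?_, ?_, ?_⟩
  · fin_cases i
    · show (![(2 : L), -2]) 0 ≠ 0
      rw [show (![(2 : L), -2]) 0 = 2 from rfl]; exact two_ne_zero
    · show (![(2 : L), -2]) 1 ≠ 0
      rw [show (![(2 : L), -2]) 1 = -2 from rfl]; exact neg_ne_zero.2 two_ne_zero
  · fin_cases i
    · show (w.1.embedding ((![(2 : L), -2]) 0)).im = 0
      rw [h0]; norm_num
    · show (w.1.embedding ((![(2 : L), -2]) 1)).im = 0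
      rw [h1]; norm_num
  · rw [h0, h1]; norm_num
  · rw [h0, h1]; norm_num

end Frame

/-! ## §2 The three off-wall heads in the Cayley frame -/

section Heads

variable (L : Type) [Field L] [NumberField L] (w : {w : InfinitePlace L // IsComplex w})
  [MeasurableSpace ↥(archLocal L 2 (Matrix.of fun i j : Fin 2 => if i.val + j.val + 1 = 2 then (1 : L) else 0) w)]
  [BorelSpace ↥(archLocal L 2 (Matrix.of fun i j : Fin 2 => if i.val + j.val + 1 = 2 then (1 : L) else 0) w)]
  (ν : Measure ↥(archLocal L 2 (Matrix.of fun i j : Fin 2 => if i.val + j.val + 1 = 2 then (1 : L) else 0) w)) [ν.IsHaarMeasure] [ν.IsMulRightInvariant]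
  {E : Type*} [NormedAddCommGroup E] [NormedSpace ℝ E] [CompleteSpace E]
  {E' : Type*} [NormedAddCommGroup E'] [NormedSpace ℝ E'] [CompleteSpace E']

omit [ν.IsHaarMeasure] [ν.IsMulRightInvariant] [NormedSpace ℝ E'] [CompleteSpace E'] in
/-- **Integrability of the conjugated test function at a regular torus point, Cayley frame**: for `sin ψ ≠ 0` and `g` continuous with compact support,
`h ↦ g(↑↑(h · P t_z(ψ) P⁻¹ · h⁻¹))` is integrable for every measure finite on compacts (the conjugating set of a compact is compact off the wall, ★
`isCompact_setOf_exists_conj_endoBlock_mem_of_not_mem`; `U(Φ₂)_w ↪ M₂(ℂ)` is closed). [cite: Rogawski1990, §8.2 p. 122] [cite: Varadarajan1989, §6.4] -/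
theorem integrable_comp_conj_cayleyTorus [IsFiniteMeasureOnCompacts ν] (z : Circle) {ψ : ℝ} (hsin : Real.sin ψ ≠ 0)
    {g : Matrix (Fin 2) (Fin 2) ℂ → E'} (hg : Continuous g) (hgc : HasCompactSupport g) :
    Integrable (fun h : ↥(archLocal L 2 (Matrix.of fun i j : Fin 2 => if i.val + j.val + 1 = 2 then (1 : L) else 0) w) =>
      g (((h * ⟨Matrix.GeneralLinearGroup.mkOfDetNeZero !![(1 : ℂ), 1; 1, -1] det_cayleyTwo_ne_zero *
              circleDiagonal 2 ![z * Circle.exp ψ, z * Circle.exp (-ψ)] *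
              (Matrix.GeneralLinearGroup.mkOfDetNeZero !![(1 : ℂ), 1; 1, -1] det_cayleyTwo_ne_zero)⁻¹,
            cayley_conj_circleDiagonal_mem_archLocal L w _⟩ * h⁻¹ :
          ↥(archLocal L 2 (Matrix.of fun i j : Fin 2 => if i.val + j.val + 1 = 2 then (1 : L) else 0) w)) : GL (Fin 2) ℂ) : Matrix (Fin 2) (Fin 2) ℂ)) ν := by
  -- adapted from ★ (α4-S3) `ArchRankOneCasimirParamAverage.two_sin_smul_integral_clm_comp_eq_integral`
  haveI : LocallyCompactSpace ↥(archLocal L 2 (Matrix.of fun i j : Fin 2 => if i.val + j.val + 1 = 2 then (1 : L) else 0) w) := locallyCompactSpace_archLocal L 2 _ w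
  set T : ↥(archLocal L 2 (Matrix.of fun i j : Fin 2 => if i.val + j.val + 1 = 2 then (1 : L) else 0) w) :=
    ⟨Matrix.GeneralLinearGroup.mkOfDetNeZero !![(1 : ℂ), 1; 1, -1] det_cayleyTwo_ne_zero *
        circleDiagonal 2 ![z * Circle.exp ψ, z * Circle.exp (-ψ)] * (Matrix.GeneralLinearGroup.mkOfDetNeZero !![(1 : ℂ), 1; 1, -1] det_cayleyTwo_ne_zero)⁻¹,
        cayley_conj_circleDiagonal_mem_archLocal L w _⟩ with hT_def
  obtain ⟨θ, hθ⟩ := Circle.exp_surjective z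
  have hT : T = endoBlock L ∅ (fun _ => ![θ + ψ, 0, θ - ψ]) w := by
    rw [hT_def]
    have h1 : z * Circle.exp ψ = Circle.exp (θ + ψ) := by rw [← hθ, Circle.exp_add]
    have h2 : z * Circle.exp (-ψ) = Circle.exp (θ - ψ) := by rw [← hθ, sub_eq_add_neg, Circle.exp_add]
    rw [h1, h2]
    unfold endoBlock
    rw [if_neg (Finset.notMem_empty w)]
    simp only [Matrix.cons_val_zero, Matrix.cons_val_two, Matrix.tail_cons, Matrix.head_cons]
  have hreg : ∀ c ∈ ({fun _ => ![θ + ψ, 0, θ - ψ]} : Set ({w : InfinitePlace L // IsComplex w} → Fin 3 → ℝ)), Circle.exp (c w 0) ≠ Circle.exp (c w 2) := by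
    intro c hc h
    rw [mem_singleton_iff.1 hc] at h
    simp only [Matrix.cons_val_zero, Matrix.cons_val_two, Matrix.tail_cons, Matrix.head_cons] at h
    obtain ⟨m, hm⟩ := Circle.exp_eq_exp.1 h
    apply hsin
    rw [show ψ = (m : ℝ) * Real.pi by linarith]
    exact Real.sin_int_mul_pi m
  have hce : IsClosedEmbedding (fun g : ↥(archLocal L 2 (Matrix.of fun i j : Fin 2 => if i.val + j.val + 1 = 2 then (1 : L) else 0) w) => ((g : GL (Fin 2) ℂ) : Matrix (Fin 2) (Fin 2) ℂ)) :=
    isClosedEmbedding_coe_unitaryGroupOfForm_of_eq_over (by rw [Literature.NumberTheory.Rogawski1990.antidiagOne_map, StdForm.over_antidiagonal_eq])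
  have hconj_c : Continuous fun h : ↥(archLocal L 2 (Matrix.of fun i j : Fin 2 => if i.val + j.val + 1 = 2 then (1 : L) else 0) w) =>
      (((h * T * h⁻¹ : ↥(archLocal L 2 (Matrix.of fun i j : Fin 2 => if i.val + j.val + 1 = 2 then (1 : L) else 0) w)) : GL (Fin 2) ℂ) : Matrix (Fin 2) (Fin 2) ℂ) :=
    hce.continuous.comp ((continuous_id.mul continuous_const).mul continuous_id.inv)
  have hKC : IsCompact {y : ↥(archLocal L 2 (Matrix.of fun i j : Fin 2 => if i.val + j.val + 1 = 2 then (1 : L) else 0) w) |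
      ∃ c ∈ ({fun _ => ![θ + ψ, 0, θ - ψ]} : Set ({w : InfinitePlace L // IsComplex w} → Fin 3 → ℝ)),
        y * endoBlock L ∅ c w * y⁻¹ ∈ (fun g : ↥(archLocal L 2 (Matrix.of fun i j : Fin 2 => if i.val + j.val + 1 = 2 then (1 : L) else 0) w) =>
          ((g : GL (Fin 2) ℂ) : Matrix (Fin 2) (Fin 2) ℂ)) ⁻¹' tsupport g} :=
    isCompact_setOf_exists_conj_endoBlock_mem_of_not_mem L w ∅ (Finset.notMem_empty w) isCompact_singleton hreg (hce.isCompact_preimage hgc)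
  refine (hg.comp hconj_c).integrable_of_hasCompactSupport (HasCompactSupport.intro hKC fun h hh => ?_)
  have hh' : ¬ (((h * T * h⁻¹ : ↥(archLocal L 2 (Matrix.of fun i j : Fin 2 => if i.val + j.val + 1 = 2 then (1 : L) else 0) w)) : GL (Fin 2) ℂ) :
      Matrix (Fin 2) (Fin 2) ℂ) ∈ tsupport g := by
    intro h'
    exact hh ⟨fun _ => ![θ + ψ, 0, θ - ψ], mem_singleton _, by rw [← hT]; exact h'⟩
  exact image_eq_zero_of_notMem_tsupport (f := g) hh'

omit [ν.IsHaarMeasure] [ν.IsMulRightInvariant] in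
/-- **`F (ℓ ∘ g) ψ = ℓ (F′ g ψ)` for EVERY `ψ`, Cayley frame**: at a regular `ψ` the Bochner integral commutes with `ℓ` (integrability by `integrable_comp_conj_cayleyTorus`); at
`sin ψ = 0` both sides vanish. [cite: Varadarajan1989, §6.4] [cite: Rogawski1990, §8.2 p. 122] -/
theorem orbitalIntegral_cayley_comp_clm [IsFiniteMeasureOnCompacts ν] (z : Circle) (F : (Matrix (Fin 2) (Fin 2) ℂ → E) → ℝ → E)
    (hF : ∀ (f : Matrix (Fin 2) (Fin 2) ℂ → E) (ψ : ℝ), F f ψ = (2 * Real.sin ψ) •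
      ∫ h : ↥(archLocal L 2 (Matrix.of fun i j : Fin 2 => if i.val + j.val + 1 = 2 then (1 : L) else 0) w),
        f (((h * ⟨Matrix.GeneralLinearGroup.mkOfDetNeZero !![(1 : ℂ), 1; 1, -1] det_cayleyTwo_ne_zero *
              circleDiagonal 2 ![z * Circle.exp ψ, z * Circle.exp (-ψ)] *
              (Matrix.GeneralLinearGroup.mkOfDetNeZero !![(1 : ℂ), 1; 1, -1] det_cayleyTwo_ne_zero)⁻¹,
            cayley_conj_circleDiagonal_mem_archLocal L w _⟩ * h⁻¹ :
          ↥(archLocal L 2 (Matrix.of fun i j : Fin 2 => if i.val + j.val + 1 = 2 then (1 : L) else 0) w)) : GL (Fin 2) ℂ) : Matrix (Fin 2) (Fin 2) ℂ) ∂ν)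
    (F' : (Matrix (Fin 2) (Fin 2) ℂ → E') → ℝ → E')
    (hF' : ∀ (g : Matrix (Fin 2) (Fin 2) ℂ → E') (ψ : ℝ), F' g ψ = (2 * Real.sin ψ) •
      ∫ h : ↥(archLocal L 2 (Matrix.of fun i j : Fin 2 => if i.val + j.val + 1 = 2 then (1 : L) else 0) w),
        g (((h * ⟨Matrix.GeneralLinearGroup.mkOfDetNeZero !![(1 : ℂ), 1; 1, -1] det_cayleyTwo_ne_zero *
              circleDiagonal 2 ![z * Circle.exp ψ, z * Circle.exp (-ψ)] *
              (Matrix.GeneralLinearGroup.mkOfDetNeZero !![(1 : ℂ), 1; 1, -1] det_cayleyTwo_ne_zero)⁻¹,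
            cayley_conj_circleDiagonal_mem_archLocal L w _⟩ * h⁻¹ :
          ↥(archLocal L 2 (Matrix.of fun i j : Fin 2 => if i.val + j.val + 1 = 2 then (1 : L) else 0) w)) : GL (Fin 2) ℂ) : Matrix (Fin 2) (Fin 2) ℂ) ∂ν)
    (ℓ : E' →L[ℝ] E) {g : Matrix (Fin 2) (Fin 2) ℂ → E'} (hg : Continuous g) (hgc : HasCompactSupport g) (ψ : ℝ) :
    F (fun X => ℓ (g X)) ψ = ℓ (F' g ψ) := by
  rw [hF, hF', map_smul]
  by_cases hsin : Real.sin ψ = 0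
  · simp only [hsin, mul_zero, zero_smul]
  · congr 1
    exact ℓ.integral_comp_comm (integrable_comp_conj_cayleyTorus L w ν z hsin hg hgc)

/-- **`F f` IS `C^∞` ON THE PUNCTURED INTERVAL, CAYLEY FRAME**: for every Haar `ν` on `U(Φ₂)_w`, `f ∈ C_c^∞(M₂(ℂ), E)` and `z ∈ S¹`,
`ContDiffOn ℝ ∞ (ψ ↦ 2 sin ψ · ∫_{U(Φ₂)_w} f(↑↑(h · P t_z(ψ) P⁻¹ · h⁻¹)) dν) (Ioo (−1) 1 ∩ {0}ᶜ)` — ★ `RankOneCasimir.contDiffOn_orbitalIntegral_punctured` at `a = (2, −2)` transported along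
★ `exists_two_sin_smul_orbitalIntegral_cayley_eq`. [cite: Varadarajan1989, §6.4 Thm 24] [cite: Rogawski1990, §8.2 p. 122] -/
theorem contDiffOn_orbitalIntegral_cayley_punctured
    (F : (Matrix (Fin 2) (Fin 2) ℂ → E) → ℝ → E) (z : Circle)
    (hF : ∀ (f : Matrix (Fin 2) (Fin 2) ℂ → E) (ψ : ℝ), F f ψ = (2 * Real.sin ψ) •
      ∫ h : ↥(archLocal L 2 (Matrix.of fun i j : Fin 2 => if i.val + j.val + 1 = 2 then (1 : L) else 0) w),
        f (((h * ⟨Matrix.GeneralLinearGroup.mkOfDetNeZero !![(1 : ℂ), 1; 1, -1] det_cayleyTwo_ne_zero *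
              circleDiagonal 2 ![z * Circle.exp ψ, z * Circle.exp (-ψ)] *
              (Matrix.GeneralLinearGroup.mkOfDetNeZero !![(1 : ℂ), 1; 1, -1] det_cayleyTwo_ne_zero)⁻¹,
            cayley_conj_circleDiagonal_mem_archLocal L w _⟩ * h⁻¹ :
          ↥(archLocal L 2 (Matrix.of fun i j : Fin 2 => if i.val + j.val + 1 = 2 then (1 : L) else 0) w)) : GL (Fin 2) ℂ) : Matrix (Fin 2) (Fin 2) ℂ) ∂ν)
    {f : Matrix (Fin 2) (Fin 2) ℂ → E} (hf : ContDiff ℝ ∞ f) (hfc : HasCompactSupport f) :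
    ContDiffOn ℝ ∞ (F f) (Ioo (-1 : ℝ) 1 ∩ {(0 : ℝ)}ᶜ) := by
  obtain ⟨e, hH, hR, hkey⟩ := exists_two_sin_smul_orbitalIntegral_cayley_eq (E := E) L w ν
  letI : MeasurableSpace ↥(unitaryGroupOfForm (starRingEnd ℂ) ((Matrix.diagonal ![(2 : L), -2]).map w.1.embedding)) := borel _
  haveI : BorelSpace ↥(unitaryGroupOfForm (starRingEnd ℂ) ((Matrix.diagonal ![(2 : L), -2]).map w.1.embedding)) := ⟨rfl⟩
  haveI := hH
  haveI := hR
  obtain ⟨ha, hreal, hsgn, hqe⟩ := cayleyDiag_frame' L w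
  obtain ⟨hfP, hfPc⟩ := contDiff_hasCompactSupport_comp_cayley' hf hfc
  have h := contDiffOn_orbitalIntegral_punctured (E := E) L ![(2 : L), -2] w ha hreal hsgn (p := 1) (q := 1) (by norm_num) hqe
    (ν.map e.symm) (fun g Y =>
      -(fderiv ℝ (fderiv ℝ g) Y (Y * !![I, 0; 0, -I]) (Y * !![I, 0; 0, -I]) + fderiv ℝ g Y (Y * !![I, 0; 0, -I] * !![I, 0; 0, -I])) +
        (fderiv ℝ (fderiv ℝ g) Y (Y * !![(0 : ℂ), ((1 : ℝ) : ℂ); ((1 : ℝ) : ℂ), 0]) (Y * !![(0 : ℂ), ((1 : ℝ) : ℂ); ((1 : ℝ) : ℂ), 0]) +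
          fderiv ℝ g Y (Y * !![(0 : ℂ), ((1 : ℝ) : ℂ); ((1 : ℝ) : ℂ), 0] * !![(0 : ℂ), ((1 : ℝ) : ℂ); ((1 : ℝ) : ℂ), 0])) +
        (fderiv ℝ (fderiv ℝ g) Y (Y * !![(0 : ℂ), -(((1 : ℝ) : ℂ) * I); ((1 : ℝ) : ℂ) * I, 0]) (Y * !![(0 : ℂ), -(((1 : ℝ) : ℂ) * I); ((1 : ℝ) : ℂ) * I, 0]) +
          fderiv ℝ g Y (Y * !![(0 : ℂ), -(((1 : ℝ) : ℂ) * I); ((1 : ℝ) : ℂ) * I, 0] * !![(0 : ℂ), -(((1 : ℝ) : ℂ) * I); ((1 : ℝ) : ℂ) * I, 0])))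
    (fun _ _ => rfl) z
    (fun g ψ => (2 * Real.sin ψ) • ∫ h' : ↥(unitaryGroupOfForm (starRingEnd ℂ) ((Matrix.diagonal ![(2 : L), -2]).map w.1.embedding)),
      g (((h' * ⟨circleDiagonal 2 ![z * Circle.exp ψ, z * Circle.exp (-ψ)], circleDiagonal_mem_archLocal_diagonal L 2 ![(2 : L), -2] w _⟩ * h'⁻¹ :
        ↥(unitaryGroupOfForm (starRingEnd ℂ) ((Matrix.diagonal ![(2 : L), -2]).map w.1.embedding))) : GL (Fin 2) ℂ) : Matrix (Fin 2) (Fin 2) ℂ) ∂(ν.map e.symm))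
    (fun _ _ => rfl) hfP hfPc
  have hfun : F f = fun ψ => (2 * Real.sin ψ) • ∫ h' : ↥(unitaryGroupOfForm (starRingEnd ℂ) ((Matrix.diagonal ![(2 : L), -2]).map w.1.embedding)),
      (fun X : Matrix (Fin 2) (Fin 2) ℂ => f ((!![(1 : ℂ), 1; 1, -1] : Matrix (Fin 2) (Fin 2) ℂ) * X * !![(1 / 2 : ℂ), 1 / 2; 1 / 2, -(1 / 2)]))
        (((h' * ⟨circleDiagonal 2 ![z * Circle.exp ψ, z * Circle.exp (-ψ)], circleDiagonal_mem_archLocal_diagonal L 2 ![(2 : L), -2] w _⟩ * h'⁻¹ :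
          ↥(unitaryGroupOfForm (starRingEnd ℂ) ((Matrix.diagonal ![(2 : L), -2]).map w.1.embedding))) : GL (Fin 2) ℂ) : Matrix (Fin 2) (Fin 2) ℂ) ∂(ν.map e.symm) :=
    funext fun ψ => (hF f ψ).trans (hkey f z ψ)
  rw [hfun]
  exact h

/-- **JETS COMMUTE WITH CONTINUOUS LINEAR MAPS OFF THE WALL, CAYLEY FRAME**: `(F (ℓ ∘ g))⁽ⁿ⁾ ψ = ℓ ((F′ g)⁽ⁿ⁾ ψ)` for `0 < |ψ| < 1`, `g ∈ C_c^∞(M₂(ℂ), E′)`, `ℓ : E′ →L[ℝ] E` —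
★ `RankOneCasimir.iteratedDeriv_orbitalIntegral_comp_clm` transported (read with `E′ = P′ →ᵇ E`, `ℓ = evalCLM ℝ p′`: the mixed partial at parameter `p′` is the evaluation of the
`(P′ →ᵇ E)`-valued jet). [cite: Varadarajan1989, §6.4 Thm 24] [cite: Bouaziz1994IntegralesOrbitales, §3.1 (I₂) p. 579] -/
theorem iteratedDeriv_orbitalIntegral_cayley_comp_clm
    (z : Circle) (F : (Matrix (Fin 2) (Fin 2) ℂ → E) → ℝ → E)
    (hF : ∀ (f : Matrix (Fin 2) (Fin 2) ℂ → E) (ψ : ℝ), F f ψ = (2 * Real.sin ψ) •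
      ∫ h : ↥(archLocal L 2 (Matrix.of fun i j : Fin 2 => if i.val + j.val + 1 = 2 then (1 : L) else 0) w),
        f (((h * ⟨Matrix.GeneralLinearGroup.mkOfDetNeZero !![(1 : ℂ), 1; 1, -1] det_cayleyTwo_ne_zero *
              circleDiagonal 2 ![z * Circle.exp ψ, z * Circle.exp (-ψ)] *
              (Matrix.GeneralLinearGroup.mkOfDetNeZero !![(1 : ℂ), 1; 1, -1] det_cayleyTwo_ne_zero)⁻¹,
            cayley_conj_circleDiagonal_mem_archLocal L w _⟩ * h⁻¹ :
          ↥(archLocal L 2 (Matrix.of fun i j : Fin 2 => if i.val + j.val + 1 = 2 then (1 : L) else 0) w)) : GL (Fin 2) ℂ) : Matrix (Fin 2) (Fin 2) ℂ) ∂ν)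
    (F' : (Matrix (Fin 2) (Fin 2) ℂ → E') → ℝ → E')
    (hF' : ∀ (g : Matrix (Fin 2) (Fin 2) ℂ → E') (ψ : ℝ), F' g ψ = (2 * Real.sin ψ) •
      ∫ h : ↥(archLocal L 2 (Matrix.of fun i j : Fin 2 => if i.val + j.val + 1 = 2 then (1 : L) else 0) w),
        g (((h * ⟨Matrix.GeneralLinearGroup.mkOfDetNeZero !![(1 : ℂ), 1; 1, -1] det_cayleyTwo_ne_zero *
              circleDiagonal 2 ![z * Circle.exp ψ, z * Circle.exp (-ψ)] *
              (Matrix.GeneralLinearGroup.mkOfDetNeZero !![(1 : ℂ), 1; 1, -1] det_cayleyTwo_ne_zero)⁻¹,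
            cayley_conj_circleDiagonal_mem_archLocal L w _⟩ * h⁻¹ :
          ↥(archLocal L 2 (Matrix.of fun i j : Fin 2 => if i.val + j.val + 1 = 2 then (1 : L) else 0) w)) : GL (Fin 2) ℂ) : Matrix (Fin 2) (Fin 2) ℂ) ∂ν)
    (ℓ : E' →L[ℝ] E) {g : Matrix (Fin 2) (Fin 2) ℂ → E'} (hg : ContDiff ℝ ∞ g) (hgc : HasCompactSupport g) (n : ℕ) {ψ : ℝ} (hψ : ψ ∈ Ioo (-1 : ℝ) 1) (hψ0 : ψ ≠ 0) :
    iteratedDeriv n (F (fun X => ℓ (g X))) ψ = ℓ (iteratedDeriv n (F' g) ψ) := by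
  haveI : LocallyCompactSpace ↥(archLocal L 2 (Matrix.of fun i j : Fin 2 => if i.val + j.val + 1 = 2 then (1 : L) else 0) w) := locallyCompactSpace_archLocal L 2 _ w
  -- `F (ℓ ∘ g) = ℓ ∘ F′ g` everywhere, and `F′ g` is `C^∞` off the wall
  have hU : IsOpen (Ioo (-1 : ℝ) 1 ∩ {(0 : ℝ)}ᶜ) := isOpen_Ioo.inter isOpen_compl_singleton
  have hcd : ContDiffAt ℝ (n : ℕ∞) (F' g) ψ :=
    (((contDiffOn_orbitalIntegral_cayley_punctured L w ν F' z hF' hg hgc).contDiffAt (hU.mem_nhds ⟨hψ, hψ0⟩)).of_le (WithTop.coe_le_coe.2 le_top))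
  have hfun : F (fun X => ℓ (g X)) = ℓ ∘ F' g :=
    funext fun ψ => orbitalIntegral_cayley_comp_clm L w ν z F hF F' hF' ℓ hg.continuous hgc ψ
  rw [hfun, iteratedDeriv_eq_iteratedFDeriv, ℓ.iteratedFDeriv_comp_left hcd le_rfl, ContinuousLinearMap.compContinuousMultilinearMap_coe,
    Function.comp_apply, ← iteratedDeriv_eq_iteratedFDeriv]

/-- **UNIFORMLY ATTAINED ONE-SIDED LIMITS OF THE JETS OF A CURRIED FAMILY, CAYLEY FRAME**: for `g ∈ C_c^∞(M₂(ℂ), E′)` and `n` there are `Lp, Lm ∈ E′` with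
`(F′ g)⁽ⁿ⁾ → Lp` along `𝓝[>] 0` and `→ Lm` along `𝓝[<] 0` IN `E′` (sup-norm convergence when `E′ = P′ →ᵇ E`), and for every `ε > 0` ONE side-neighbourhood on which
`‖(F (ℓ ∘ g))⁽ⁿ⁾ ψ − ℓ Lp‖ ≤ ‖ℓ‖ · ε` (resp. `Lm`) for ALL `ℓ : E′ →L[ℝ] E` — ★ `…cayley_nhdsGT_nhdsLT` at `E := E′` + §2 `iteratedDeriv_orbitalIntegral_cayley_comp_clm` +
★ `eventually_forall_norm_clm_sub_le_of_tendsto`. [cite: Varadarajan1989, §6.4 Thms 22–24] [cite: Bouaziz1994IntegralesOrbitales, §3.2 (I₃) p. 580] -/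
theorem exists_tendsto_iteratedDeriv_orbitalIntegral_cayley_comp_clm_uniform
    (z : Circle) (F : (Matrix (Fin 2) (Fin 2) ℂ → E) → ℝ → E)
    (hF : ∀ (f : Matrix (Fin 2) (Fin 2) ℂ → E) (ψ : ℝ), F f ψ = (2 * Real.sin ψ) •
      ∫ h : ↥(archLocal L 2 (Matrix.of fun i j : Fin 2 => if i.val + j.val + 1 = 2 then (1 : L) else 0) w),
        f (((h * ⟨Matrix.GeneralLinearGroup.mkOfDetNeZero !![(1 : ℂ), 1; 1, -1] det_cayleyTwo_ne_zero *
              circleDiagonal 2 ![z * Circle.exp ψ, z * Circle.exp (-ψ)] *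
              (Matrix.GeneralLinearGroup.mkOfDetNeZero !![(1 : ℂ), 1; 1, -1] det_cayleyTwo_ne_zero)⁻¹,
            cayley_conj_circleDiagonal_mem_archLocal L w _⟩ * h⁻¹ :
          ↥(archLocal L 2 (Matrix.of fun i j : Fin 2 => if i.val + j.val + 1 = 2 then (1 : L) else 0) w)) : GL (Fin 2) ℂ) : Matrix (Fin 2) (Fin 2) ℂ) ∂ν)
    (F' : (Matrix (Fin 2) (Fin 2) ℂ → E') → ℝ → E')
    (hF' : ∀ (g : Matrix (Fin 2) (Fin 2) ℂ → E') (ψ : ℝ), F' g ψ = (2 * Real.sin ψ) •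
      ∫ h : ↥(archLocal L 2 (Matrix.of fun i j : Fin 2 => if i.val + j.val + 1 = 2 then (1 : L) else 0) w),
        g (((h * ⟨Matrix.GeneralLinearGroup.mkOfDetNeZero !![(1 : ℂ), 1; 1, -1] det_cayleyTwo_ne_zero *
              circleDiagonal 2 ![z * Circle.exp ψ, z * Circle.exp (-ψ)] *
              (Matrix.GeneralLinearGroup.mkOfDetNeZero !![(1 : ℂ), 1; 1, -1] det_cayleyTwo_ne_zero)⁻¹,
            cayley_conj_circleDiagonal_mem_archLocal L w _⟩ * h⁻¹ :
          ↥(archLocal L 2 (Matrix.of fun i j : Fin 2 => if i.val + j.val + 1 = 2 then (1 : L) else 0) w)) : GL (Fin 2) ℂ) : Matrix (Fin 2) (Fin 2) ℂ) ∂ν)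
    {g : Matrix (Fin 2) (Fin 2) ℂ → E'} (hg : ContDiff ℝ ∞ g) (hgc : HasCompactSupport g) (n : ℕ) :
    ∃ Lp Lm : E',
      (Tendsto (fun ψ => iteratedDeriv n (F' g) ψ) (𝓝[>] 0) (𝓝 Lp) ∧ Tendsto (fun ψ => iteratedDeriv n (F' g) ψ) (𝓝[<] 0) (𝓝 Lm)) ∧
      (∀ ℓ : E' →L[ℝ] E, Tendsto (fun ψ => iteratedDeriv n (F (fun X => ℓ (g X))) ψ) (𝓝[>] 0) (𝓝 (ℓ Lp)) ∧
        Tendsto (fun ψ => iteratedDeriv n (F (fun X => ℓ (g X))) ψ) (𝓝[<] 0) (𝓝 (ℓ Lm))) ∧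
      ∀ ε : ℝ, 0 < ε →
        (∀ᶠ ψ in 𝓝[>] (0 : ℝ), ∀ ℓ : E' →L[ℝ] E, ‖iteratedDeriv n (F (fun X => ℓ (g X))) ψ - ℓ Lp‖ ≤ ‖ℓ‖ * ε) ∧
        (∀ᶠ ψ in 𝓝[<] (0 : ℝ), ∀ ℓ : E' →L[ℝ] E, ‖iteratedDeriv n (F (fun X => ℓ (g X))) ψ - ℓ Lm‖ ≤ ‖ℓ‖ * ε) := by
  obtain ⟨Lp, Lm, hLp, hLm⟩ := exists_tendsto_iteratedDeriv_orbitalIntegral_cayley_nhdsGT_nhdsLT (E := E') L w ν F' z hF' hg hgc n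
  have hmem : Ioo (-1 : ℝ) 1 ∩ {(0 : ℝ)}ᶜ ∈ 𝓝[≠] (0 : ℝ) :=
    inter_mem (mem_nhdsWithin_of_mem_nhds (Ioo_mem_nhds (by norm_num) (by norm_num))) self_mem_nhdsWithin
  have hcomm : ∀ ψ ∈ Ioo (-1 : ℝ) 1 ∩ {(0 : ℝ)}ᶜ, ∀ ℓ : E' →L[ℝ] E, iteratedDeriv n (F (fun X => ℓ (g X))) ψ = ℓ (iteratedDeriv n (F' g) ψ) := fun ψ hψ ℓ =>
    iteratedDeriv_orbitalIntegral_cayley_comp_clm L w ν z F hF F' hF' ℓ hg hgc n hψ.1 hψ.2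
  have hcongr : ∀ (ℓ : E' →L[ℝ] E) {l : Filter ℝ}, l ≤ 𝓝[≠] (0 : ℝ) →
      (fun ψ => ℓ (iteratedDeriv n (F' g) ψ)) =ᶠ[l] fun ψ => iteratedDeriv n (F (fun X => ℓ (g X))) ψ := fun ℓ l hl =>
    Filter.eventually_of_mem (hl hmem) fun ψ hψ => (hcomm ψ hψ ℓ).symm
  refine ⟨Lp, Lm, ⟨hLp, hLm⟩, fun ℓ => ⟨?_, ?_⟩, fun ε hε => ⟨?_, ?_⟩⟩
  · exact ((ℓ.continuous.tendsto Lp).comp hLp).congr' (hcongr ℓ (nhdsGT_le_nhdsNE 0))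
  · exact ((ℓ.continuous.tendsto Lm).comp hLm).congr' (hcongr ℓ (nhdsLT_le_nhdsNE 0))
  · filter_upwards [eventually_forall_norm_clm_sub_le_of_tendsto (E := E) hLp hε, nhdsGT_le_nhdsNE 0 hmem] with ψ hψ hψU ℓ
    rw [hcomm ψ hψU ℓ]
    exact hψ ℓ
  · filter_upwards [eventually_forall_norm_clm_sub_le_of_tendsto (E := E) hLm hε, nhdsLT_le_nhdsNE 0 hmem] with ψ hψ hψU ℓ
    rw [hcomm ψ hψU ℓ]
    exact hψ ℓ

end Heads

end Literature.NumberTheory.Automorphic.UnitaryGroup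

end
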